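import Mathlib
import Summits.Ventures.PercRepro.TriangleCapZoneNarrowArith
import Summits.Ventures.PercRepro.TriangleCapZoneTwo

/-!
# PercRepro — ONE BELOW THE THRESHOLD FOR EVERY `D ≥ 2 r`: THE WINDOW `r < I ≤ D − r` AND THE FULL THEOREM
(p3, gen 56; part 333)

At `m = D + r − 2`, `t = m D + r`, `2 ≤ r ≤ D / 2`, with `I` inside edges in the window `r < I ≤ D − r`
(`d = I − r`, `σ = 2 r + d ≤ D`), every graph of the band has `2 j + 2 t (D − 1) + 2 (r − 1)(r − 2) ≥ t (t − 1) + 2 r (D − r)`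
(`zone_window_bound`).  The rows split into `F` full, `P` partial (sum `S_p`) and empty ones, `D F + S_p = m D − d`;
an inside edge `x x'` has `c(x) + c(x') ≤ F + P + I + 1`.  If `F + P ≤ m` the two ends are bounded by `D + σ − 1` and
the column loss at the residue `σ` (part 328; at `σ = D` the residue `0`, part 330) plus the rows' `φ_D(D − d)` exceed
`g(r − 1)` (part 332 (A)).  Otherwise `P ≥ q + 1` where `S_p = q D − d`, the uniform row bound of part 331 is
monotone in `P` (part 332) and at `P = q + 1` evaluates to `(q + 1)(D − 1) + φ_{D−2}((q − 1)(D − 2) + (D − 2 − e))`,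
`e = d + 1 − q`, which with the columns' `φ_D(σ)` exceeds `g(r − 1)` (part 332 (B)).  With parts 329 and 330 this
gives THE EXACT BOTTOM ONE BELOW THE THRESHOLD FOR EVERY `D ≥ 2 r` (`zone_one_below_exact_all`):
`C(t,2) − t (D − 1) + r (D − r) − (r − 1)(r − 2)`.  Axioms: standard.
-/

namespace PercRepro

namespace TriangleCap

namespace C047

open Finset

variable {V : Type*} [Fintype V] [DecidableEq V]

/-- The final step of the column-loss branch (`σ < D`): from the deficiency identity and the two bounds. -/
theorem window_final_A (D r d I j t Ccol Crow : ℕ) (hr : 2 ≤ r) (hd : 1 ≤ d) (hσ : 2 * r + d + 1 ≤ D)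
    (hI : I = r + d) (hdef : 2 * j + 2 * (t * (D - 1)) = t * (t - 1) + 2 * I + Ccol + Crow)
    (hcol : (2 * r + d) * (D - (2 * r + d)) + (2 * (2 * r + d) - 2) ≤ Ccol) (hrow : (D - d) * d ≤ Crow) :
    t * (t - 1) + 2 * (r * (D - r)) ≤ 2 * j + 2 * (t * (D - 1)) + 2 * ((r - 1) * (r - 2)) := by
  have hA := window_arith_A D r d hr hd hσ
  omega

/-- The final step of the column-loss branch at `σ = D`. -/
theorem window_final_A_top (D r d I j t Ccol Crow : ℕ) (hr : 2 ≤ r) (hd : 1 ≤ d) (hσ : 2 * r + d = D)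
    (hI : I = r + d) (hdef : 2 * j + 2 * (t * (D - 1)) = t * (t - 1) + 2 * I + Ccol + Crow)
    (hcol : 2 * (D - 1) ≤ Ccol) (hrow : (D - d) * d ≤ Crow) :
    t * (t - 1) + 2 * (r * (D - r)) ≤ 2 * j + 2 * (t * (D - 1)) + 2 * ((r - 1) * (r - 2)) := by
  have hA := window_arith_A_top D r hr (by omega)
  have e : (D - d) * d = 2 * r * (D - 2 * r) := by
    rw [show D - d = 2 * r by omega, show d = D - 2 * r by omega]
  omega

/-- The final step of the row branch: the rows cost at least `(d − e + 2)(D − 1) + (D − (e + 2)) e`. -/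
theorem window_final_B (D r d e I j t Ccol Crow : ℕ) (hr : 2 ≤ r) (hdD : 2 * r + d ≤ D) (hed : e ≤ d)
    (hI : I = r + d) (hdef : 2 * j + 2 * (t * (D - 1)) = t * (t - 1) + 2 * I + Ccol + Crow)
    (hcol : (2 * r + d) * (D - (2 * r + d)) ≤ Ccol) (hrow : (d - e + 2) * (D - 1) + (D - (e + 2)) * e ≤ Crow) :
    t * (t - 1) + 2 * (r * (D - r)) ≤ 2 * j + 2 * (t * (D - 1)) + 2 * ((r - 1) * (r - 2)) := by
  have hB := window_arith_B D r d e hr hdD hed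
  omega

/-- **(B) MORE THAN `m` ACTIVE ROWS:** `F` full rows, `P` partial rows of sum `S_p` with `D F + S_p = m D − d`,
`F + P ≥ m + 1`, `P ≤ S_p`; the uniform row bound `P (D − 1) + φ_{D−2}(S_p − P) ≤ Crow` is monotone in `P` and at
`P = q + 1` (`S_p = q D − d`) gives, with the columns' `σ (D − σ) ≤ Ccol` and the deficiency identity, the window bound. -/
theorem window_branch_B (D r d m I j t F P Sp Ccol Crow : ℕ) (hr : 2 ≤ r) (hd1 : 1 ≤ d) (hdD : 2 * r + d ≤ D)
    (hI : I = r + d) (hmD : d ≤ m * D) (hFS : D * F + Sp = m * D - d) (hR : m + 1 ≤ F + P) (hPS : P ≤ Sp)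
    (hrowcost : P * (D - 1) + phiD (D - 2) (Sp - P) ≤ Crow)
    (hcolphi : (2 * r + d) * (D - (2 * r + d)) ≤ Ccol)
    (hdef : 2 * j + 2 * (t * (D - 1)) = t * (t - 1) + 2 * I + Ccol + Crow) :
    t * (t - 1) + 2 * (r * (D - r)) ≤ 2 * j + 2 * (t * (D - 1)) + 2 * ((r - 1) * (r - 2)) := by
  have hD3 : 3 ≤ D := by omega
  have hFm : F + 1 ≤ m := by
    have h1 : D * F < m * D := by omega
    rw [Nat.mul_comm D] at h1
    have := Nat.lt_of_mul_lt_mul_right h1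
    omega
  obtain ⟨q, hq⟩ : ∃ q, m = F + q := ⟨m - F, by omega⟩
  have hq1 : 1 ≤ q := by omega
  have hSp : Sp + d = q * D := by
    have : m * D = F * D + q * D := by rw [hq]; ring
    rw [Nat.mul_comm D] at hFS
    omega
  have hPq : q + 1 ≤ P := by omega
  have hmono := uniform_row_mono D Sp (q + 1) P hD3 hPq hPS
  rcases Nat.lt_or_ge (q - 1) d with hcase | hcase
  · -- `e = d + 1 − q ≥ 1`: `S_p − (q + 1) = (D − 2)(q − 1) + (D − 2 − e)`
    obtain ⟨e, he⟩ : ∃ e, d + 1 = q + e := ⟨d + 1 - q, by omega⟩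
    have he1 : 1 ≤ e := by omega
    have hed : e ≤ d := by omega
    have hphi : phiD (D - 2) (Sp - (q + 1)) = (D - (e + 2)) * e := by
      obtain ⟨q', rfl⟩ : ∃ q', q = q' + 1 := ⟨q - 1, by omega⟩
      obtain ⟨D', rfl⟩ : ∃ D', D = D' + 2 := ⟨D - 2, by omega⟩
      have hmul : (q' + 1) * (D' + 2) = q' * D' + 2 * q' + D' + 2 := by ring
      have eSp : Sp - (q' + 1 + 1) = D' * q' + (D' - e) := by
        have hmul2 : D' * q' = q' * D' := Nat.mul_comm _ _
        omega
      rw [eSp, show D' + 2 - 2 = D' by omega, phiD_mod, Nat.mul_add_mod, Nat.mod_eq_of_lt (by omega : D' - e < D'),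
        phiD_of_lt D' _ (by omega)]
      have e1 : D' - (D' - e) = e := by omega
      have e2 : D' + 2 - (e + 2) = D' - e := by omega
      rw [e1, e2]
    have hq' : q + 1 = d - e + 2 := by omega
    rw [hphi, hq'] at hmono
    exact window_final_B D r d e I j t Ccol Crow hr hdD hed hI hdef hcolphi (le_trans hmono hrowcost)
  · -- `d ≤ q − 1`: `(q + 1)(D − 1) ≥ (d + 2)(D − 1)` and `φ ≥ 0`
    have hle : (d + 2) * (D - 1) ≤ (q + 1) * (D - 1) := Nat.mul_le_mul_right _ (by omega)
    have hrow0 : (d - 0 + 2) * (D - 1) + (D - (0 + 2)) * 0 ≤ Crow := by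
      rw [Nat.sub_zero, mul_zero, add_zero]
      omega
    exact window_final_B D r d 0 I j t Ccol Crow hr hdD (Nat.zero_le d) hI hdef hcolphi hrow0

/-- **THE WINDOW `r < I ≤ D − r` ONE BELOW THE THRESHOLD:** every graph of the band with `I` inside edges,
`r < I ≤ D − r`, has `t (t − 1) + 2 r (D − r) ≤ 2 j + 2 t (D − 1) + 2 (r − 1)(r − 2)`. -/
theorem zone_window_bound (H : SimpleGraph V) [DecidableRel H.Adj] (hfree : H.CliqueFree 3) (s m r D j : ℕ)
    (hr : 2 ≤ r) (h2 : 2 * r ≤ D) (hm : m + 2 = D + r) (hs : H.edgeFinset.card = s) (w : V)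
    (hw : deg H w + (m * D + r) = s) (hw1 : 1 ≤ deg H w)
    (hj : ∑ v, deg H v * deg H v + 2 * ((m * D + r) * (s - (m * D + r) - 1)) + 2 * j = s * (s + 1))
    (hD : ∀ v, offDeg H w v ≤ D) (hI1 : r < (insideEdges H w).card) (hI2 : (insideEdges H w).card ≤ D - r) :
    (m * D + r) * (m * D + r - 1) + 2 * (r * (D - r)) ≤
      2 * j + 2 * ((m * D + r) * (D - 1)) + 2 * ((r - 1) * (r - 2)) := by
  obtain ⟨I, hI⟩ : ∃ I, (insideEdges H w).card = I := ⟨_, rfl⟩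
  rw [hI] at hI1 hI2
  obtain ⟨d, hd⟩ : ∃ d, I = r + d := ⟨I - r, by omega⟩
  have hd1 : 1 ≤ d := by omega
  have hdD : 2 * r + d ≤ D := by omega
  have hD0 : 0 < D := by omega
  have hm1 : 2 ≤ m := by omega
  have hdef := deficiency_identity_split H hfree s (m * D + r) j D hs w hw hw1 hj hD
  have hoff : (offEdges H w).card = m * D + r := by
    have := card_offEdges_add_deg H w
    omega
  have hatt := attach_add_card_inside H hfree w
  rw [hoff, hI] at hatt
  have hsumcol := sum_offDeg_nonNbrs_eq_add_card_inside H hfree w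
  rw [hoff, hI] at hsumcol
  rw [hI] at hdef
  have hsumrow : ∑ y ∈ univ.filter (fun y => H.Adj w y), offDeg H w y = m * D + r - I := by
    unfold attach at hatt
    omega
  have hmD : d ≤ m * D := by
    have : D ≤ m * D := Nat.le_mul_of_pos_left D (by omega)
    omega
  have hcolval : ∑ x ∈ nonNbrs H w, offDeg H w x = m * D + (2 * r + d) := by omega
  have hrowval : ∑ y ∈ univ.filter (fun y => H.Adj w y), offDeg H w y = m * D - d := by omega
  -- the rows: full / partial / empty
  set rows := univ.filter (fun y => H.Adj w y) with hrows
  set Fset := rows.filter (fun y => offDeg H w y = D) with hFset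
  set Pset := rows.filter (fun y => 1 ≤ offDeg H w y ∧ offDeg H w y < D) with hPset
  have hrowsplit : ∑ y ∈ rows, offDeg H w y = D * Fset.card + ∑ y ∈ Pset, offDeg H w y := by
    rw [← sum_filter_add_sum_filter_not rows (fun y => offDeg H w y = D),
      sum_const_nat (m := D) (fun y hy => (mem_filter.mp hy).2), Nat.mul_comm]
    congr 1
    rw [← sum_filter_add_sum_filter_not (rows.filter (fun y => ¬ offDeg H w y = D)) (fun y => 1 ≤ offDeg H w y),
      sum_eq_zero (s := (rows.filter (fun y => ¬ offDeg H w y = D)).filter (fun y => ¬ 1 ≤ offDeg H w y))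
        (f := offDeg H w) (fun y hy => by rw [mem_filter] at hy; omega), add_zero, filter_filter]
    apply sum_congr _ (fun _ _ => rfl)
    apply filter_congr
    intro y _
    have := hD y
    constructor
    · rintro ⟨h1, h2⟩
      exact ⟨h2, by omega⟩
    · rintro ⟨h1, h2⟩
      exact ⟨by omega, h1⟩
  have hactive : (rows.filter (fun y => 1 ≤ offDeg H w y)).card = Fset.card + Pset.card := by
    rw [← card_filter_add_card_filter_not (s := rows.filter (fun y => 1 ≤ offDeg H w y))
      (fun y => offDeg H w y = D)]
    congr 1
    · rw [filter_filter]
      congr 1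
      apply filter_congr
      intro y _
      constructor
      · rintro ⟨-, h⟩
        exact h
      · intro h
        exact ⟨by omega, h⟩
    · rw [filter_filter]
      congr 1
      apply filter_congr
      intro y _
      have := hD y
      constructor
      · rintro ⟨h1, h2⟩
        exact ⟨h1, by omega⟩
      · rintro ⟨h1, h2⟩
        exact ⟨h1, by omega⟩
  -- the uniform row bound on the partial rows
  have hrowcost : Pset.card * (D - 1) + phiD (D - 2) (∑ y ∈ Pset, offDeg H w y - Pset.card) ≤
      ∑ y ∈ rows, offDeg H w y * (D - offDeg H w y) := by
    have h1 := sum_partial_ge_card_add_phi Pset (offDeg H w) D (fun y hy => (mem_filter.mp hy).2.1)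
      (fun y hy => (mem_filter.mp hy).2.2)
    have hPsub : Pset ⊆ rows := filter_subset _ _
    have h2 := sum_le_sum_of_subset (f := fun y => offDeg H w y * (D - offDeg H w y)) hPsub
    omega
  -- the φ-bounds of both sides
  have hrowphi := sum_mul_sub_ge_phi rows (offDeg H w) D (fun y _ => hD y)
  rw [hrowval] at hrowphi
  have hphirow : phiD D (m * D - d) = (D - d) * d := by
    obtain ⟨m', rfl⟩ : ∃ m', m = m' + 1 := ⟨m - 1, by omega⟩
    have e : (m' + 1) * D - d = D * m' + (D - d) := by
      have : (m' + 1) * D = D * m' + D := by ring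
      omega
    rw [e, phiD_mod, Nat.mul_add_mod, Nat.mod_eq_of_lt (by omega : D - d < D), phiD_of_lt D _ (by omega)]
    congr 1
    omega
  rw [hphirow] at hrowphi
  have hcolphi := sum_mul_sub_ge_phi (nonNbrs H w) (offDeg H w) D (fun x _ => hD x)
  rw [hcolval] at hcolphi
  have hphicol : phiD D (m * D + (2 * r + d)) = (2 * r + d) * (D - (2 * r + d)) := by
    rw [phiD_mod, Nat.mul_comm, Nat.mul_add_mod, ← phiD_mod, phiD_of_le D _ hdD]
  rw [hphicol] at hcolphi
  -- the inside edge
  obtain ⟨x, hx, x', hx', hxx'⟩ := exists_adj_nonNbrs H w (by omega)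
  have hnb := nbrDeg_add_nbrDeg_le_active H hfree w x x' hx hx' hxx'
  have hin := inDeg_add_inDeg_le_inside_succ H w x x' hx hx' hxx'
  rw [hI] at hin
  have hcx := offDeg_eq_nbrDeg_add_inDeg H w x hx
  have hcx' := offDeg_eq_nbrDeg_add_inDeg H w x' hx'
  have hin1 : 1 ≤ inDeg H w x := by
    unfold inDeg
    exact card_pos.mpr ⟨x', mem_filter.mpr ⟨hx', hxx'⟩⟩
  have hin1' : 1 ≤ inDeg H w x' := by
    unfold inDeg
    exact card_pos.mpr ⟨x, mem_filter.mpr ⟨hx, H.adj_symm hxx'⟩⟩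
  have hactset : (univ.filter (fun y => H.Adj w y ∧ 1 ≤ offDeg H w y)).card =
      (rows.filter (fun y => 1 ≤ offDeg H w y)).card := by
    rw [hrows, filter_filter]
  rw [hactset, hactive] at hnb
  have hDx := hD x
  have hDx' := hD x'
  have hFS : D * Fset.card + ∑ y ∈ Pset, offDeg H w y = m * D - d := by
    rw [← hrowsplit, hrowval]
  rcases Nat.lt_or_ge (Fset.card + Pset.card) (m + 1) with hR | hR
  · -- at most `m` active rows: the column loss
    have hends : offDeg H w x + offDeg H w x' ≤ D + (2 * r + d) - 1 := by omega
    rcases Nat.lt_or_ge (2 * r + d) D with hσ | hσ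
    · have hsumσ : (∑ x ∈ nonNbrs H w, offDeg H w x) % D = 2 * r + d := by
        rw [hcolval, Nat.mul_comm, Nat.mul_add_mod, Nat.mod_eq_of_lt hσ]
      have hloss := column_loss_sigma (nonNbrs H w) (offDeg H w) D (2 * r + d) (by omega) (by omega)
        (fun z _ => hD z) x x' hx hx' (H.ne_of_adj hxx') (by omega) (by omega) hends hsumσ
      rw [phiD_of_lt D _ hσ] at hloss
      exact window_final_A D r d I j (m * D + r) _ _ hr hd1 (by omega) hd hdef hloss hrowphi
    · have hσD : 2 * r + d = D := by omega
      have hsum0 : (∑ x ∈ nonNbrs H w, offDeg H w x) % D = 0 := by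
        rw [hcolval, hσD, show m * D + D = (m + 1) * D by ring, Nat.mul_mod_left]
      have hloss : 2 * (D - 1) ≤ ∑ x ∈ nonNbrs H w, offDeg H w x * (D - offDeg H w x) := by
        rcases Nat.lt_or_ge (offDeg H w x) D with hxlt | hxge
        · exact column_loss_zero (nonNbrs H w) (offDeg H w) D (by omega) (fun z _ => hD z) x hx (by omega)
            (by omega) hsum0
        · exact column_loss_zero (nonNbrs H w) (offDeg H w) D (by omega) (fun z _ => hD z) x' hx' (by omega)
            (by omega) hsum0
      exact window_final_A_top D r d I j (m * D + r) _ _ hr hd1 hσD hd hdef hloss hrowphi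
  · -- more than `m` active rows: the partial rows carry the deficiency
    have hPS : Pset.card ≤ ∑ y ∈ Pset, offDeg H w y := by
      rw [card_eq_sum_ones]
      exact sum_le_sum (fun y hy => (mem_filter.mp hy).2.1)
    exact window_branch_B D r d m I j (m * D + r) Fset.card Pset.card (∑ y ∈ Pset, offDeg H w y) _ _ hr hd1 hdD hd
      hmD hFS hR hPS hrowcost hcolphi hdef

/-- **THE LOWER BOUND ONE BELOW THE THRESHOLD, EVERY `D ≥ 2 r`:** for `2 ≤ r`, `2 r ≤ D`, `m + 2 = D + r`,
`t = m D + r`, every triangle-free `H` with `s` edges, `w` of degree `s − t ≥ 1`, every off-degree `≤ D`, at the band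
value `2 j` has `t (t − 1) + 2 r (D − r) ≤ 2 j + 2 t (D − 1) + 2 (r − 1)(r − 2)`. -/
theorem zone_one_below_bound_all (H : SimpleGraph V) [DecidableRel H.Adj] (hfree : H.CliqueFree 3)
    (s m r D j : ℕ) (hr : 2 ≤ r) (h2 : 2 * r ≤ D) (hm : m + 2 = D + r) (hs : H.edgeFinset.card = s) (w : V)
    (hw : deg H w + (m * D + r) = s) (hw1 : 1 ≤ deg H w)
    (hj : ∑ v, deg H v * deg H v + 2 * ((m * D + r) * (s - (m * D + r) - 1)) + 2 * j = s * (s + 1))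
    (hD : ∀ v, offDeg H w v ≤ D) :
    (m * D + r) * (m * D + r - 1) + 2 * (r * (D - r)) ≤
      2 * j + 2 * ((m * D + r) * (D - 1)) + 2 * ((r - 1) * (r - 2)) := by
  have hD0 : 0 < D := by omega
  have hmod : (m * D + r) % D = r := by
    rw [Nat.add_comm, Nat.add_mul_mod_self_right, Nat.mod_eq_of_lt (by omega)]
  have hdef := deficiency_identity_split H hfree s (m * D + r) j D hs w hw hw1 hj hD
  have hoff : (offEdges H w).card = m * D + r := by
    have := card_offEdges_add_deg H w
    omega
  have hatt := attach_add_card_inside H hfree w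
  rw [hoff] at hatt
  have hsumcol := sum_offDeg_nonNbrs_eq_add_card_inside H hfree w
  rw [hoff] at hsumcol
  have hsumrow : ∑ y ∈ univ.filter (fun y => H.Adj w y), offDeg H w y = m * D + r - (insideEdges H w).card := by
    unfold attach at hatt
    omega
  have hIt : (insideEdges H w).card ≤ m * D + r := by omega
  have hcol := sum_mul_sub_ge_phi (nonNbrs H w) (offDeg H w) D (fun x _ => hD x)
  have hrow := sum_mul_sub_ge_phi (univ.filter (fun y => H.Adj w y)) (offDeg H w) D (fun y _ => hD y)
  rw [hsumcol] at hcol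
  rw [hsumrow] at hrow
  rcases Nat.lt_or_ge (insideEdges H w).card r with hlt | hge
  · have := residue_one_below_lt D (m * D + r) (insideEdges H w).card hIt (by omega) (by omega) (by omega)
    rw [hmod] at this
    omega
  rcases Nat.eq_or_lt_of_le hge with heq | hgt
  · exact zone_bound_I_eq_r H hfree s m r D j hr h2 (by omega) hs w hw hw1 hj hD heq.symm
  rcases Nat.lt_or_ge (D - r) (insideEdges H w).card with hw' | hw'
  · have := residue_one_below_wrap D (m * D + r) (insideEdges H w).card hIt (by omega) (by omega) (by omega)
    rw [hmod] at this
    omega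
  · exact zone_window_bound H hfree s m r D j hr h2 hm hs w hw hw1 hj hD hgt hw'

/-- **THE EXACT BOTTOM ONE BELOW THE THRESHOLD, EVERY `D ≥ 2 r`:** for `2 ≤ r`, `2 r ≤ D`, `m + 2 = D + r`,
`t = m D + r`, `m + 1 ≤ ℓ`, `2 t ≤ s`: every graph on `ℓ + 1 + (s − t)` vertices with a vertex of degree `s − t` and
every off-degree `≤ D` has `t (t − 1) + 2 r (D − r) ≤ 2 j + 2 t (D − 1) + 2 (r − 1)(r − 2)`, and the star family with
`r − 1` inside edges attains it — the bottom is `C(t,2) − t (D − 1) + r (D − r) − (r − 1)(r − 2)`. -/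
theorem zone_one_below_exact_all (s ℓ m r D : ℕ) (hr : 2 ≤ r) (h2 : 2 * r ≤ D) (hm : m + 2 = D + r)
    (hmℓ : m + 1 ≤ ℓ) (hs : 2 * (m * D + r) ≤ s) :
    (∀ (H : SimpleGraph (Fin (ℓ + 1 + (s - (m * D + r))))) [DecidableRel H.Adj], H.CliqueFree 3 →
      H.edgeFinset.card = s → ∀ w, deg H w + (m * D + r) = s → (∀ v, offDeg H w v ≤ D) →
      ∀ j, ∑ v, deg H v * deg H v + 2 * ((m * D + r) * (s - (m * D + r) - 1)) + 2 * j = s * (s + 1) →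
      (m * D + r) * (m * D + r - 1) + 2 * (r * (D - r)) ≤
        2 * j + 2 * ((m * D + r) * (D - 1)) + 2 * ((r - 1) * (r - 2))) ∧
    (∃ (H : SimpleGraph (Fin (ℓ + 1 + (s - (m * D + r))))) (_ : DecidableRel H.Adj), H.CliqueFree 3 ∧
      H.edgeFinset.card = s ∧ ∃ w, deg H w + (m * D + r) = s ∧ (∀ v, offDeg H w v ≤ D) ∧
        (∃ x, ¬ H.Adj w x ∧ offDeg H w x = D) ∧
        ∃ j, ∑ v, deg H v * deg H v + 2 * ((m * D + r) * (s - (m * D + r) - 1)) + 2 * j = s * (s + 1) ∧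
          2 * j + 2 * ((m * D + r) * (D - 1)) + 2 * ((r - 1) * (r - 2)) =
            (m * D + r) * (m * D + r - 1) + 2 * (r * (D - r))) := by
  refine ⟨fun H _ hfree hsH w hw hD' j hj => ?_, zone_one_below_witness s ℓ m r D hr h2 hm hmℓ hs⟩
  have hw1 : 1 ≤ deg H w := by omega
  exact zone_one_below_bound_all H hfree s m r D j hr h2 hm hsH w hw hw1 hj hD'

end C047

end TriangleCap

end PercRepro
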